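import Literature.NumberTheory.LFunctions.NoExceptionalZeroUpTo
import HarnessLib

/-!
# Explicit `ψ(x; q, a)` bounds for non-exceptional moduli (Bennett–Martin–O'Bryant–Rechnitzer
# 2018, Lemma 6.12), consumed over a certified no-exceptional-zero range

Topic `Literature/NumberTheory/LFunctions`; namespace `Literature.NumberTheory.LFunctions.BMOR2018`.
One constant (`R₁`), ONE named fact AS PRINTED (`lemma612_psi`, D-0014, not discharged), and
THEOREMS — the EXPLICIT-constant consumer of a no-exceptional-zero table (the proof-of-data rung of
the column whose criterion is `NoExceptionalZeroUpTo`, `NoExceptionalZeroUpTo.lean`).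

## What the source prints

M. A. Bennett, G. Martin, K. O'Bryant, A. Rechnitzer, *Explicit bounds for primes in arithmetic
progressions*, Illinois J. Math. 62 (2018) 427–532 = arXiv:1802.00085 (held), §6:

* Definition 6.1: "Define `R₁ = 9.645908801`. We define an exceptional zero of `L(s, χ)` to be a
  real zero `β` of `L(s, χ)` with `β ≥ 1 − 1/(R₁ log q)`." (Zeros are those of
  `𝒵(χ) = {ρ : 0 < β < 1, L(ρ, χ) = 0}`, §2.)
* **Lemma 6.12.** "For `q ≥ 10⁵` and `x ≥ e^{4R₁ log² q}`,
  `|ψ(x; q, a) − x/φ(q)| ≤ (1.012/φ(q)) x^{1 − 40/(√q log² q)} + 1.4579 x √(log x/R₁) exp(−√(log x/R₁))`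
  and [the same for `θ` with `+ 1.001 √x`], where the first term on each right-hand side is
  present only if an exceptional zero exists for a quadratic `L`-function with conductor `q`."
  (Throughout §6, `gcd(a, q) = 1`; `ψ(x; q, a) = ∑_{n ≤ x, n ≡ a (q)} Λ(n)`.)
* After Cor. 6.17: "If `q` is a modulus for which the corresponding quadratic `L`-functions have no
  exceptional zero, all these results hold with a much weaker condition on the size of `x`. In
  particular, this is the case, via Platt, for `10⁵ < q ≤ 4·10⁵`."

## Contents

* `BMOR2018.R₁ = 9.645908801`; `BMOR2018.errTerm x = 1.4579 · x · √(log x/R₁) · exp(−√(log x/R₁))`.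
* `BMOR2018.lemma612_psi` — **named fact, the `ψ`-part of Lemma 6.12 as printed**, both clauses: for
  `q ≥ 10⁵`, `a` a unit mod `q`, `x ≥ exp(4R₁ log² q)`: the two-term bound, AND the one-term bound
  `|ψ(x; q, a) − x/φ(q)| ≤ errTerm x` under the hypothesis that no quadratic (`IsQuadratic`,
  principal character included — a harmless strengthening of the hypothesis) `χ` mod `q` has a
  real zero `β` with `1 − 1/(R₁ log q) ≤ β < 1`. `ψ(x; q, a)` is the tree's
  `Literature.NumberTheory.Sieve.ParityWave0.chebyshevPsiMod`. The `θ`-part is not typed (no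
  `θ(x; q, a)` of record in this directory). Not discharged: the proof is McCurley's explicit
  machinery (Prop. 6.2, Lemmas 6.7–6.10) plus the explicit bound `β₀ ≤ 1 − 40/(√q log² q)`.
* `BMOR2018.nonexceptional_of_noExceptionalZeroUpTo` — a table `NoExceptionalZeroUpTo Q c₀` with
  `c₀ ≥ 1/R₁` supplies the hypothesis of the one-term clause at every `10⁵ ≤ q ≤ Q` (quadratic
  `χ ≠ χ₀`: `NoExceptionalZeroUpTo.lfunction_ne_zero`, the window `[1 − 1/(R₁ log q), 1)` lying in
  `[1 − c₀/log q, 1]` and to the right of `0`; `χ₀`: `L(β, χ₀) = ζ(β)∏(1 − p^{−β}) ≠ 0` on `(0, 1)`).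
* **The explicit consumer** `BMOR2018.psi_bound_of_noExceptionalZeroUpTo`:
  `lemma612_psi → NoExceptionalZeroUpTo Q c₀ → 1/R₁ ≤ c₀ →` for all `10⁵ ≤ q ≤ Q`, units `a`,
  `x ≥ exp(4R₁ log² q)`: `|ψ(x; q, a) − x/φ(q)| ≤ 1.4579 x √(log x/R₁) exp(−√(log x/R₁))` — a de la
  Vallée-Poussin-type bound with NUMERICAL constants, for `log x ≥ 4R₁ log² q` instead of the
  paper's unconditional `log x ≥ κ₁ √q log³ q` (Prop. 6.16).
* the instance of record over Platt's range, `BMOR2018.psi_bound_platt`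
  (`platt2016_theorem71 → lemma612_psi →` the bound for `10⁵ ≤ q ≤ 4·10⁵`), which is the remark
  after Cor. 6.17 made a kernel statement (conditional on the two named facts).

## References

* M. A. Bennett, G. Martin, K. O'Bryant, A. Rechnitzer, Illinois J. Math. 62 (2018) 427–532,
  Definition 6.1, Lemma 6.12, Propositions 6.16, 6.18. [BennettMartinOBryantRechnitzer2018]
* K. S. McCurley, J. Number Theory 19 (1984) 7–32, Theorem 1 and p. 8. [McCurley1984ZFR]
* D. J. Platt, Math. Comp. 85 (2016) 3009–3027, Theorem 7.1. [Platt2016GRH]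
-/

noncomputable section

open Complex Literature.Barriers.Parity

namespace Literature.NumberTheory.LFunctions

namespace BMOR2018

/-- Bennett–Martin–O'Bryant–Rechnitzer's constant `R₁ = 9.645908801` (McCurley's zero-free region
constant). [cite: BennettMartinOBryantRechnitzer2018, Definition 6.1] -/
def R₁ : ℝ := 9.645908801

/-- The error term of Lemma 6.12 in the non-exceptional case:
`1.4579 · x · √(log x / R₁) · exp(−√(log x / R₁))`. [cite: BennettMartinOBryantRechnitzer2018, Lemma 6.12] -/
def errTerm (x : ℝ) : ℝ :=
  1.4579 * x * Real.sqrt (Real.log x / R₁) * Real.exp (-Real.sqrt (Real.log x / R₁))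

/-- **Bennett–Martin–O'Bryant–Rechnitzer 2018, Lemma 6.12, `ψ`-part (as printed): "For `q ≥ 10⁵`
and `x ≥ e^{4R₁ log² q}`,
`|ψ(x; q, a) − x/φ(q)| ≤ (1.012/φ(q)) x^{1 − 40/(√q log² q)} + 1.4579 x √(log x/R₁) exp(−√(log x/R₁))`
…, where the first term on each right-hand side is present only if an exceptional zero exists for
a quadratic `L`-function with conductor `q`."** (`gcd(a, q) = 1`; exceptional zero per Definition
6.1: a real zero `β ∈ 𝒵(χ)`, i.e. `0 < β < 1`, with `β ≥ 1 − 1/(R₁ log q)`.) Rendering: `a` a unit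
of `ZMod q`; `ψ(x; q, a)` = `ParityWave0.chebyshevPsiMod q a x = ∑_{n ≤ x, n ≡ a (q)} Λ(n)`; the
first clause is the two-term bound, the second the one-term bound under "no quadratic
(`MulChar.IsQuadratic`, so the principal character is included — a harmless strengthening of the
hypothesis, hence a weakening of the fact) `χ` mod `q` has a real zero `β` with
`1 − 1/(R₁ log q) ≤ β < 1`". Not discharged here (McCurley's explicit method, §6.2, size L).
[cite: BennettMartinOBryantRechnitzer2018, Lemma 6.12] -/
def lemma612_psi : Prop :=
  ∀ (q : ℕ) [NeZero q], 10 ^ 5 ≤ q → ∀ (a : (ZMod q)ˣ) (x : ℝ),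
    Real.exp (4 * R₁ * Real.log q ^ 2) ≤ x →
      |Literature.NumberTheory.Sieve.ParityWave0.chebyshevPsiMod q a x - x / q.totient| ≤
          1.012 / q.totient * x ^ (1 - 40 / (Real.sqrt q * Real.log q ^ 2)) + errTerm x ∧
      ((∀ χ : DirichletCharacter ℂ q, χ.IsQuadratic →
          ∀ β : ℝ, 1 - 1 / (R₁ * Real.log q) ≤ β → β < 1 → χ.LFunction β ≠ 0) →
        |Literature.NumberTheory.Sieve.ParityWave0.chebyshevPsiMod q a x - x / q.totient| ≤
          errTerm x)

/-- `R₁ = 9.645908801 > 0`. [cite: BennettMartinOBryantRechnitzer2018, Definition 6.1] -/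
theorem R₁_pos : 0 < R₁ := by unfold R₁; norm_num

/-- **The table supplies the non-exceptional hypothesis.** Under `NoExceptionalZeroUpTo Q c₀` with
`1/R₁ ≤ c₀`: for every modulus `10⁵ ≤ q ≤ Q`, no quadratic `χ` mod `q` (principal included) has a
real zero `β` with `1 − 1/(R₁ log q) ≤ β < 1`. For `χ ≠ χ₀` this is
`NoExceptionalZeroUpTo.lfunction_ne_zero` (`1 − c₀/log q ≤ 1 − 1/(R₁ log q) ≤ β`, and `β > 0` since
`R₁ log q > 1`); for `χ₀`, `L(β, χ₀) = ζ(β)∏_{p ∣ q}(1 − p^{−β}) ≠ 0` on `(0, 1)`.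
[cite: BennettMartinOBryantRechnitzer2018, Definition 6.1] -/
theorem nonexceptional_of_noExceptionalZeroUpTo {Q : ℕ} {c₀ : ℝ} (hN : NoExceptionalZeroUpTo Q c₀)
    (hc : 1 / R₁ ≤ c₀) {q : ℕ} [NeZero q] (hq : 10 ^ 5 ≤ q) (hqQ : q ≤ Q)
    (χ : DirichletCharacter ℂ q) (hquad : χ.IsQuadratic) {β : ℝ}
    (hβ : 1 - 1 / (R₁ * Real.log q) ≤ β) (hβ1 : β < 1) : χ.LFunction β ≠ 0 := by
  have hq3 : (3 : ℝ) ≤ q := by exact_mod_cast (show 3 ≤ q by omega)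
  have hlog3 : 1 < Real.log 3 := by
    have h := Real.exp_one_lt_d9
    rw [Real.lt_log_iff_exp_lt (by norm_num)]
    linarith
  have hlogq : 1 < Real.log q := lt_of_lt_of_le hlog3 (Real.log_le_log (by norm_num) hq3)
  have hR := R₁_pos
  have hR1 : 1 < R₁ := by unfold R₁; norm_num
  have hRlog : 1 < R₁ * Real.log q := by nlinarith
  have hβ0 : 0 < β := by
    have : 1 / (R₁ * Real.log q) < 1 := by
      rw [div_lt_one (by linarith)]; exact hRlog
    linarith
  by_cases hχ : χ = 1
  · subst hχ
    exact GoldstonSuriajaya.LFunction_one_ne_zero_of_pos_of_lt_one q hβ0 hβ1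
  · refine hN.lfunction_ne_zero hqQ χ hquad hχ hβ0 ?_
    have h1 : 1 / (R₁ * Real.log q) ≤ c₀ / Real.log q := by
      rw [div_le_div_iff₀ (by linarith) (by linarith)]
      have : 1 ≤ R₁ * c₀ := by
        have := mul_le_mul_of_nonneg_left hc hR.le
        rwa [mul_one_div_cancel hR.ne'] at this
      nlinarith
    linarith

/-- **The explicit consumer of the table.** Assume the named fact `lemma612_psi` and a table
`NoExceptionalZeroUpTo Q c₀` with `1/R₁ ≤ c₀` (`1/R₁ = 0.1036…`; Platt's range gives `c₀ = 1/2`).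
Then for every modulus `10⁵ ≤ q ≤ Q`, every unit `a` mod `q` and every `x ≥ exp(4R₁ log² q)`:
`|ψ(x; q, a) − x/φ(q)| ≤ 1.4579 · x · √(log x/R₁) · exp(−√(log x/R₁))`.
[cite: BennettMartinOBryantRechnitzer2018, Lemma 6.12 and Proposition 6.18] -/
theorem psi_bound_of_noExceptionalZeroUpTo (h612 : lemma612_psi) {Q : ℕ} {c₀ : ℝ}
    (hN : NoExceptionalZeroUpTo Q c₀) (hc : 1 / R₁ ≤ c₀) {q : ℕ} [NeZero q] (hq : 10 ^ 5 ≤ q)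
    (hqQ : q ≤ Q) (a : (ZMod q)ˣ) {x : ℝ} (hx : Real.exp (4 * R₁ * Real.log q ^ 2) ≤ x) :
    |Literature.NumberTheory.Sieve.ParityWave0.chebyshevPsiMod q a x - x / q.totient| ≤ errTerm x :=
  (h612 q hq a x hx).2 fun χ hquad _ hβ hβ1 ↦
    nonexceptional_of_noExceptionalZeroUpTo hN hc hq hqQ χ hquad hβ hβ1

/-- The same with the error term spelled out.
[cite: BennettMartinOBryantRechnitzer2018, Lemma 6.12 and Proposition 6.18] -/
theorem psi_bound_of_noExceptionalZeroUpTo' (h612 : lemma612_psi) {Q : ℕ} {c₀ : ℝ}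
    (hN : NoExceptionalZeroUpTo Q c₀) (hc : 1 / R₁ ≤ c₀) {q : ℕ} [NeZero q] (hq : 10 ^ 5 ≤ q)
    (hqQ : q ≤ Q) (a : (ZMod q)ˣ) {x : ℝ} (hx : Real.exp (4 * R₁ * Real.log q ^ 2) ≤ x) :
    |Literature.NumberTheory.Sieve.ParityWave0.chebyshevPsiMod q a x - x / q.totient| ≤
      1.4579 * x * Real.sqrt (Real.log x / 9.645908801) *
        Real.exp (-Real.sqrt (Real.log x / 9.645908801)) :=
  psi_bound_of_noExceptionalZeroUpTo h612 hN hc hq hqQ a hx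

/-- **Instance of record over Platt's range** (the remark after Cor. 6.17, as a kernel statement
conditional on the two named facts `platt2016_theorem71` and `lemma612_psi`): for every modulus
`10⁵ ≤ q ≤ 4·10⁵`, every unit `a` mod `q` and every `x ≥ exp(4R₁ log² q)`,
`|ψ(x; q, a) − x/φ(q)| ≤ 1.4579 · x · √(log x/R₁) · exp(−√(log x/R₁))` (here
`noExceptionalZeroUpTo_platt` supplies `c₀ = 1/2 ≥ 1/R₁`).
[cite: BennettMartinOBryantRechnitzer2018, Proposition 6.18 (remark before)] -/
theorem psi_bound_platt (hP : platt2016_theorem71) (h612 : lemma612_psi) {q : ℕ} [NeZero q]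
    (hq : 10 ^ 5 ≤ q) (hqQ : q ≤ 400000) (a : (ZMod q)ˣ) {x : ℝ}
    (hx : Real.exp (4 * R₁ * Real.log q ^ 2) ≤ x) :
    |Literature.NumberTheory.Sieve.ParityWave0.chebyshevPsiMod q a x - x / q.totient| ≤ errTerm x :=
  psi_bound_of_noExceptionalZeroUpTo h612 (noExceptionalZeroUpTo_platt hP)
    (by unfold R₁; norm_num) hq hqQ a hx


/-! ### Lemma 6.14 in the kernel: the log-power form `x/(5 (log x)^Z)` of the error term -/

/-- **The key inequality behind Lemma 6.14, multiplicative form.** If `0 < u₀ ≤ u`, `Z ≥ 0`,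
`7.2895 · u₀ · (R₁u₀²)^Z ≤ e^{u₀}` and `1 + 2Z ≤ u₀`, then `7.2895 · u · (R₁u²)^Z ≤ e^{u}`: with
`s = u/u₀ ≥ 1` the left side is the value at `u₀` times `s^{1+2Z} ≤ e^{(1+2Z)(s−1)} ≤ e^{u₀(s−1)}`
(`log s ≤ s − 1`). This replaces the monotonicity of `f(u) = log(e^u/(7.2895u))/log(Ru²)` in the
printed proof. [cite: BennettMartinOBryantRechnitzer2018, Lemma 6.14] -/
theorem key_le_exp {u u₀ Z : ℝ} (hu₀ : 0 < u₀) (hu : u₀ ≤ u) (hZ : 0 ≤ Z)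
    (h1 : 7.2895 * u₀ * (R₁ * u₀ ^ 2) ^ Z ≤ Real.exp u₀) (h2 : 1 + 2 * Z ≤ u₀) :
    7.2895 * u * (R₁ * u ^ 2) ^ Z ≤ Real.exp u := by
  have hR := R₁_pos
  set s : ℝ := u / u₀ with hs
  have hs1 : 1 ≤ s := by rw [hs, le_div_iff₀ hu₀]; linarith
  have hs0 : 0 < s := by linarith
  have hus : u = u₀ * s := by rw [hs]; field_simp
  have hA : 0 ≤ R₁ * u₀ ^ 2 := by positivity
  have eq1 : (R₁ * u ^ 2) ^ Z = (R₁ * u₀ ^ 2) ^ Z * s ^ (2 * Z) := by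
    rw [hus, show R₁ * (u₀ * s) ^ 2 = (R₁ * u₀ ^ 2) * s ^ 2 by ring,
      Real.mul_rpow hA (by positivity), show (s ^ 2 : ℝ) = s ^ (2 : ℝ) by norm_cast,
      ← Real.rpow_mul hs0.le]
  have eq2 : 7.2895 * u * (R₁ * u ^ 2) ^ Z =
      (7.2895 * u₀ * (R₁ * u₀ ^ 2) ^ Z) * s ^ (1 + 2 * Z) := by
    rw [eq1, Real.rpow_add hs0, Real.rpow_one, hus]; ring
  have h3 : s ^ (1 + 2 * Z) ≤ Real.exp (u - u₀) := by
    rw [Real.rpow_def_of_pos hs0, Real.exp_le_exp]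
    have hlog : Real.log s ≤ s - 1 := Real.log_le_sub_one_of_pos hs0
    have e : u - u₀ = u₀ * (s - 1) := by rw [hus]; ring
    rw [e]
    calc Real.log s * (1 + 2 * Z) ≤ (s - 1) * (1 + 2 * Z) :=
          mul_le_mul_of_nonneg_right hlog (by linarith)
      _ ≤ (s - 1) * u₀ := mul_le_mul_of_nonneg_left h2 (by linarith)
      _ = u₀ * (s - 1) := by ring
  have h0 : 0 ≤ 7.2895 * u₀ * (R₁ * u₀ ^ 2) ^ Z := by positivity
  calc 7.2895 * u * (R₁ * u ^ 2) ^ Z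
      = (7.2895 * u₀ * (R₁ * u₀ ^ 2) ^ Z) * s ^ (1 + 2 * Z) := eq2
    _ ≤ Real.exp u₀ * Real.exp (u - u₀) :=
        mul_le_mul h1 h3 (Real.rpow_nonneg hs0.le _) (Real.exp_pos _).le
    _ = Real.exp u := by rw [← Real.exp_add]; ring_nf

/-- **Lemma 6.14 (the case `R = R₁`), exponential form.** Let `κ₂ > 1`, `Z ≥ 0`, put
`u₀ = √(κ₂/R₁)`, and assume `7.2895 · u₀ · κ₂^Z ≤ e^{u₀}` (equivalently, taking logarithms, the
printed hypothesis `Z ≤ (√(κ₂/R₁) + log(√R₁/7.2895))/log κ₂ − 1/2`) and `1 + 2Z ≤ u₀` (automatic in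
the printed uses, where `u₀ ≥ 23`). Then for every `x ≥ e^{κ₂}`,
`1.4579 · x · √(log x/R₁) · e^{−√(log x/R₁)} ≤ x/(5 (log x)^Z)`. (Print: "`1 ≤ R ≤ 10`"; only
`R = R₁` is used, Prop. 6.16.) [cite: BennettMartinOBryantRechnitzer2018, Lemma 6.14] -/
theorem errTerm_le_div_rpow {κ₂ Z x : ℝ} (hκ : 1 < κ₂) (hZ : 0 ≤ Z)
    (h1 : 7.2895 * Real.sqrt (κ₂ / R₁) * κ₂ ^ Z ≤ Real.exp (Real.sqrt (κ₂ / R₁)))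
    (h2 : 1 + 2 * Z ≤ Real.sqrt (κ₂ / R₁)) (hx : Real.exp κ₂ ≤ x) :
    errTerm x ≤ x / (5 * Real.log x ^ Z) := by
  have hR := R₁_pos
  have hx0 : 0 < x := (Real.exp_pos _).trans_le hx
  have hL : κ₂ ≤ Real.log x := by rw [← Real.log_exp κ₂]; exact Real.log_le_log (Real.exp_pos _) hx
  have hL0 : 0 < Real.log x := by linarith
  set u : ℝ := Real.sqrt (Real.log x / R₁) with hudef
  set u₀ : ℝ := Real.sqrt (κ₂ / R₁) with hu₀def
  have hu₀ : 0 < u₀ := Real.sqrt_pos.2 (div_pos (by linarith) hR)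
  have hu₀u : u₀ ≤ u := Real.sqrt_le_sqrt (div_le_div_of_nonneg_right hL hR.le)
  have hu2 : R₁ * u ^ 2 = Real.log x := by
    rw [hudef, Real.sq_sqrt (div_pos hL0 hR).le]; field_simp
  have hu₀2 : R₁ * u₀ ^ 2 = κ₂ := by
    rw [hu₀def, Real.sq_sqrt (div_pos (by linarith) hR).le]; field_simp
  have hkey : 7.2895 * u * (R₁ * u ^ 2) ^ Z ≤ Real.exp u :=
    key_le_exp hu₀ hu₀u hZ (by rw [hu₀2]; exact h1) h2
  rw [hu2] at hkey
  have hpow : 0 < Real.log x ^ Z := Real.rpow_pos_of_pos hL0 Z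
  -- `errTerm x = x · (7.2895 u (log x)^Z / e^u) / (5 (log x)^Z)`
  have hrepr : errTerm x = x / (5 * Real.log x ^ Z) * (7.2895 * u * Real.log x ^ Z / Real.exp u) := by
    unfold errTerm
    rw [← hudef, Real.exp_neg]
    field_simp
    norm_num
    ring
  rw [hrepr]
  have hle1 : 7.2895 * u * Real.log x ^ Z / Real.exp u ≤ 1 := by
    rw [div_le_one (Real.exp_pos _)]; exact hkey
  have hnn : 0 ≤ x / (5 * Real.log x ^ Z) := by positivity
  calc x / (5 * Real.log x ^ Z) * (7.2895 * u * Real.log x ^ Z / Real.exp u)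
      ≤ x / (5 * Real.log x ^ Z) * 1 := mul_le_mul_of_nonneg_left hle1 hnn
    _ = x / (5 * Real.log x ^ Z) := mul_one _

/-- `e^{2.3} ≤ 10`, so `log 10 ≥ 2.3` and `log q ≥ 11.5` for `q ≥ 10⁵` (Taylor bound for `exp` at
`0.575`, fourth power). [folklore] -/
private theorem exp_two_point_three_le : Real.exp 2.3 ≤ 10 := by
  have hx0 : (0 : ℝ) ≤ 0.575 := by norm_num
  have hx1 : (0.575 : ℝ) ≤ 1 := by norm_num
  have hu := Real.exp_bound' hx0 hx1 (n := 12) (by norm_num)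
  simp only [Finset.sum_range_succ, Finset.sum_range_zero] at hu
  have e : Real.exp 2.3 = Real.exp 0.575 ^ 4 := by
    rw [← Real.exp_nat_mul]; norm_num
  rw [e]
  exact le_trans (pow_le_pow_left₀ (Real.exp_nonneg _) hu 4) (by norm_num [Nat.factorial])

/-- For `q ≥ 10⁵`: `11.5 ≤ log q`. [folklore] -/
private theorem log_ge_of_ge_ten_pow_five {q : ℕ} (hq : 10 ^ 5 ≤ q) : 11.5 ≤ Real.log q := by
  have hq' : (10 : ℝ) ^ 5 ≤ q := by exact_mod_cast hq
  have h10 : 2.3 ≤ Real.log 10 := by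
    rw [Real.le_log_iff_exp_le (by norm_num)]; exact exp_two_point_three_le
  have h5 : Real.log ((10 : ℝ) ^ 5) = 5 * Real.log 10 := by
    rw [Real.log_pow]; norm_num
  have : Real.log ((10 : ℝ) ^ 5) ≤ Real.log q := Real.log_le_log (by norm_num) hq'
  linarith

/-- The numerical heart of the `Z = 2` instance: for `L ≥ 11.5`, `21704 · L⁵ ≤ e^{2L}`
(at `L = 11.5`: `4.37·10⁹ ≤ e²³ = 9.74·10⁹`; then `(L/11.5)⁵ ≤ e^{5(L − 11.5)/11.5} ≤ e^{2(L − 11.5)}`).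
[folklore] -/
private theorem pow_five_le_exp {L : ℝ} (hL : 11.5 ≤ L) : 21704 * L ^ 5 ≤ Real.exp (2 * L) := by
  have he : (2.7182818283 : ℝ) < Real.exp 1 := Real.exp_one_gt_d9
  have h23 : (21704 : ℝ) * 11.5 ^ 5 ≤ Real.exp 23 := by
    have h1 : (2.7182818283 : ℝ) ^ 23 ≤ Real.exp 1 ^ 23 :=
      pow_le_pow_left₀ (by norm_num) he.le 23
    rw [← Real.exp_nat_mul] at h1
    norm_num at h1
    exact le_trans (by norm_num) h1
  set t : ℝ := L - 11.5 with ht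
  have ht0 : 0 ≤ t := by linarith
  have hL' : L = 11.5 * (1 + t / 11.5) := by rw [ht]; ring
  have h1 : (1 + t / 11.5) ^ 5 ≤ Real.exp (2 * t) := by
    have ha : 1 + t / 11.5 ≤ Real.exp (t / 11.5) := by
      have := Real.add_one_le_exp (t / 11.5); linarith
    calc (1 + t / 11.5) ^ 5 ≤ Real.exp (t / 11.5) ^ 5 :=
          pow_le_pow_left₀ (by positivity) ha 5
      _ = Real.exp (5 * (t / 11.5)) := by rw [← Real.exp_nat_mul]; norm_num
      _ ≤ Real.exp (2 * t) := Real.exp_le_exp.2 (by linarith)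
  have h2 : L ^ 5 = 11.5 ^ 5 * (1 + t / 11.5) ^ 5 := by rw [hL']; ring
  have h3 : Real.exp (2 * L) = Real.exp 23 * Real.exp (2 * t) := by
    rw [← Real.exp_add]; congr 1; rw [ht]; ring
  rw [h2, h3]
  calc 21704 * (11.5 ^ 5 * (1 + t / 11.5) ^ 5) = (21704 * 11.5 ^ 5) * (1 + t / 11.5) ^ 5 := by ring
    _ ≤ Real.exp 23 * Real.exp (2 * t) := mul_le_mul h23 h1 (by positivity) (Real.exp_pos _).le

/-- **The `Z = 2` instance of Lemma 6.14 at `κ₂ = 4R₁ log² q`, `q ≥ 10⁵`:** for every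
`x ≥ exp(4R₁ log² q)`, `errTerm x ≤ x/(5 log² x)`. (Here `u₀ = 2 log q ≥ 23`, and the hypothesis of
`errTerm_le_div_rpow` reads `7.2895 · 2 log q · (4R₁ log² q)² = 233.264 R₁² log⁵ q ≤ 21704 log⁵ q ≤ q²`.)
[cite: BennettMartinOBryantRechnitzer2018, Lemma 6.14 and Proposition 6.16] -/
theorem errTerm_le_div_log_sq {q : ℕ} (hq : 10 ^ 5 ≤ q) {x : ℝ}
    (hx : Real.exp (4 * R₁ * Real.log q ^ 2) ≤ x) : errTerm x ≤ x / (5 * Real.log x ^ 2) := by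
  have hR := R₁_pos
  have hLq : 11.5 ≤ Real.log q := log_ge_of_ge_ten_pow_five hq
  have hLq0 : 0 < Real.log q := by linarith
  set κ₂ : ℝ := 4 * R₁ * Real.log q ^ 2 with hκdef
  have hu₀ : Real.sqrt (κ₂ / R₁) = 2 * Real.log q := by
    rw [hκdef, show 4 * R₁ * Real.log q ^ 2 / R₁ = (2 * Real.log q) ^ 2 by field_simp; ring]
    exact Real.sqrt_sq (by linarith)
  have hκ1 : 1 < κ₂ := by
    rw [hκdef]; unfold R₁; nlinarith
  have h := errTerm_le_div_rpow (Z := 2) hκ1 (by norm_num) ?_ ?_ hx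
  · rw [Real.rpow_two] at h; exact h
  · rw [hu₀, Real.rpow_two, hκdef]
    have hq2 := pow_five_le_exp hLq
    have hc : 7.2895 * (2 * Real.log q) * (4 * R₁ * Real.log q ^ 2) ^ 2 ≤ 21704 * Real.log q ^ 5 := by
      have : 7.2895 * (2 * Real.log q) * (4 * R₁ * Real.log q ^ 2) ^ 2 =
          (233.264 * R₁ ^ 2) * Real.log q ^ 5 := by ring
      rw [this]
      refine mul_le_mul_of_nonneg_right ?_ (by positivity)
      unfold R₁; norm_num
    exact hc.trans hq2
  · rw [hu₀]; linarith

/-- **The explicit consumer in log-power form** (Bennett–Martin–O'Bryant–Rechnitzer Prop. 6.16/6.18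
shape, `Z = 2`): under `lemma612_psi` and a table `NoExceptionalZeroUpTo Q c₀` with `1/R₁ ≤ c₀`, for
every modulus `10⁵ ≤ q ≤ Q`, every unit `a` mod `q` and every `x ≥ exp(4R₁ log² q)`
(`4R₁ = 38.583635204`): `|ψ(x; q, a) − x/φ(q)| ≤ x/(5 log² x)`.
[cite: BennettMartinOBryantRechnitzer2018, Proposition 6.18] -/
theorem psi_bound_log_sq_of_noExceptionalZeroUpTo (h612 : lemma612_psi) {Q : ℕ} {c₀ : ℝ}
    (hN : NoExceptionalZeroUpTo Q c₀) (hc : 1 / R₁ ≤ c₀) {q : ℕ} [NeZero q] (hq : 10 ^ 5 ≤ q)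
    (hqQ : q ≤ Q) (a : (ZMod q)ˣ) {x : ℝ} (hx : Real.exp (4 * R₁ * Real.log q ^ 2) ≤ x) :
    |Literature.NumberTheory.Sieve.ParityWave0.chebyshevPsiMod q a x - x / q.totient| ≤
      x / (5 * Real.log x ^ 2) :=
  (psi_bound_of_noExceptionalZeroUpTo h612 hN hc hq hqQ a hx).trans (errTerm_le_div_log_sq hq hx)

/-- The same over Platt's range `10⁵ ≤ q ≤ 4·10⁵` (conditional on `platt2016_theorem71` and
`lemma612_psi`). [cite: BennettMartinOBryantRechnitzer2018, Proposition 6.18 (remark before)] -/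
theorem psi_bound_log_sq_platt (hP : platt2016_theorem71) (h612 : lemma612_psi) {q : ℕ} [NeZero q]
    (hq : 10 ^ 5 ≤ q) (hqQ : q ≤ 400000) (a : (ZMod q)ˣ) {x : ℝ}
    (hx : Real.exp (4 * R₁ * Real.log q ^ 2) ≤ x) :
    |Literature.NumberTheory.Sieve.ParityWave0.chebyshevPsiMod q a x - x / q.totient| ≤
      x / (5 * Real.log x ^ 2) :=
  psi_bound_log_sq_of_noExceptionalZeroUpTo h612 (noExceptionalZeroUpTo_platt hP)
    (by unfold R₁; norm_num) hq hqQ a hx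

end BMOR2018

end Literature.NumberTheory.LFunctions

end
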